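import Summits.BirchSwinnertonDyer.Rank1Residual.P2.CongruentNumberSilentEvenFiveEnclosureBridged
import Summits.BirchSwinnertonDyer.Rank1Residual.P2.CongruentNumberSilentEvenFiveSelmerEightAoki
import Summits.BirchSwinnertonDyer.Rank1Residual.P2.CongruentNumberSilentEvenFiveEnclosureRungTwo
import Literature.NumberTheory.QuadraticFields.RedeiReichardtFourRank
import HarnessLib

/-!
# Cell «bsd-monsky» (typer): THE FLAG-MINIMAL CORNER — C-P2-1 relative to Aoki 1999 Thm. 2.2 (`hAo`, refereed, complete
# printed proofs) and the BRIDGED system fact `hSys‴` (Tian Thm. 2.8 system ∧ TYZ Thm. 3.3 at `χ₀` ∧ TYZ p. 749 ∧ the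
# point identification (8.1.4) ∧ Gauss genus theory), and the `k = 2` rung of C-P2-2 with Rédei–Reichardt DISCHARGED

HONEST FRAMING: nothing asserted; conditional on the displayed facts `hAo` (`Aoki1999.thm22_card_selmerGroup_two`,
N. Aoki, Comment. Math. Univ. St. Pauli 48 (1999) Thm. 2.2 — the re-sourced 2-Selmer input, prover-A's
`…SelmerEightAoki.lean`) and `hSys‴` (`Tian2014.tian2014_system_sMinus_bridged`). After ROUND 245 (referee B: M is
LITERAL-by-name while the flags `HB94-even-sketch@hMe` and `B4-assembly@…` stand) this corner carries neither `hMe`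
nor `h515`, and on the Gross–Zagier side only the single relation `CMPointData.tianPointIdentification` (PROOF-A (8.1.4))
remains a displayed assembly. Rédei–Reichardt is now a tree theorem (`RedeiReichardt.redeiReichardt_fourTwoCard_classGroup_holds`,
p405187), so the `hR` binders of the landed rung files are discharged here by instantiation. One-line compositions;
rungs `k ≥ 3` untouched; nothing booked.
-/

noncomputable section

open scoped Classical

open WeierstrassCurve NumberField Literature.NumberTheory.EllipticCurves
  Literature.NumberTheory.EllipticCurves.Aoki1999 Literature.NumberTheory.QuadraticFields.RedeiReichardt

set_option autoImplicit false

namespace Summit.BirchSwinnertonDyer.Rank1Residual.P2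

open Conjectures Literature.NumberTheory.EllipticCurves.Tian2014
  Literature.NumberTheory.EllipticCurves.HeathBrown1994
  Literature.NumberTheory.EllipticCurves.TianYuanZhang2017
  Literature.NumberTheory.EllipticCurves.Rank1Residual
  Literature.NumberTheory.EllipticCurves.Rank1Residual.Typed

/-! ## §1 C-P2-1 from {`hAo`, `hSys″`} and from {`hAo`, `hSys‴`} -/

/-- **C-P2-1 relative to Aoki 1999 Thm. 2.2 and the SPLIT system fact.** Sorry-free; nothing asserted.
[cite: Aoki1999, Thm. 2.2 (p. 81)] [cite: Tian2014, Thm. 2.8 (J132), Notations (J122–123)]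
[cite: TianYuanZhang2017, Thm. 3.3 (p. 739)] [cite: Miller2011LMS, Def. 1.1] -/
theorem congruentSilentEvenFiveBSDTwo_of_splitSystem_of_aoki (hAo : thm22_card_selmerGroup_two)
    (hSys : tian2014_system_sMinus_split) : CongruentSilentEvenFiveBSDTwo :=
  congruentSilentEvenFiveBSDTwo_of_genusSystem_of_aoki hAo (tian2014_system_sMinus_genus_of_split hSys)

/-- **THE FLAG-MINIMAL CORNER: C-P2-1 relative to Aoki 1999 Thm. 2.2 and the BRIDGED system fact** — no `hMe`, no
`h515`, no GZK binder, no Monsky 1990 binder; the only displayed assembly is `CMPointData.tianPointIdentification`.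
Sorry-free; nothing asserted. [cite: Aoki1999, Thm. 2.2 (p. 81)] [cite: Tian2014, Thm. 2.8 (J132), Def. 2.7 (p0011 L25–L36), Notations (J122–123)]
[cite: TianYuanZhang2017, Thm. 3.3 (p. 739), p. 749] [cite: Miller2011LMS, Def. 1.1] -/
theorem congruentSilentEvenFiveBSDTwo_of_bridgedSystem_of_aoki (hAo : thm22_card_selmerGroup_two)
    (hSys : tian2014_system_sMinus_bridged) : CongruentSilentEvenFiveBSDTwo :=
  congruentSilentEvenFiveBSDTwo_of_splitSystem_of_aoki hAo (tian2014_system_sMinus_split_of_bridged hSys)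

/-! ## §2 The `k = 2` rung of C-P2-2 with Rédei–Reichardt discharged -/

/-- **THE SILENT `k = 2` RUNG `CongruentSilentEvenBSDTwoAt 2` from {`hAo`, `hSys‴`}** — Rédei–Reichardt discharged by
`redeiReichardt_fourTwoCard_classGroup_holds`. Conditional; nothing asserted.
[cite: Monsky1990MockHeegner, Remark (3) (p. 67)] [cite: Aoki1999, Thm. 2.2 (p. 81)] [cite: TianYuanZhang2017, Thm. 1.2, Thm. 3.3]
[cite: RedeiReichardt1934, Satz (pp. 69–74)] -/
theorem congruentSilentEvenBSDTwoAt_two_of_bridgedSystem_of_aoki (hAo : thm22_card_selmerGroup_two)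
    (hSys : tian2014_system_sMinus_bridged) : CongruentSilentEvenBSDTwoAt 2 :=
  congruentSilentEvenBSDTwoAt_two_of_congruentSilentEvenFiveBSDTwo redeiReichardt_fourTwoCard_classGroup_holds
    (congruentSilentEvenFiveBSDTwo_of_bridgedSystem_of_aoki hAo hSys)

/-- **THE SILENT `k = 2` RUNG from {`hMe`, `hSys′`}, Rédei–Reichardt discharged** (the landed
`congruentSilentEvenBSDTwoAt_two_of_genusSystem_of_monskyEven` without its `hR` binder). Conditional; nothing asserted.
[cite: Monsky1990MockHeegner, Remark (3) (p. 67)] [cite: HeathBrown1994SelmerCongruentII, Appendix (Monsky)]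
[cite: RedeiReichardt1934, Satz (pp. 69–74)] -/
theorem congruentSilentEvenBSDTwoAt_two_of_genusSystem_of_monskyEven' (hMe : monsky_card_selmerGroup_two_even)
    (hSys : tian2014_system_sMinus_genus) : CongruentSilentEvenBSDTwoAt 2 :=
  congruentSilentEvenBSDTwoAt_two_of_genusSystem_of_monskyEven redeiReichardt_fourTwoCard_classGroup_holds hMe hSys

/-- **THE `k = 2` RUNG `CongruentEvenBSDTwoAt 2` from {U⁺, GZK, `hMe`, `hSys‴`}** — silent cells by the bridged
enclosure, loud cells by DOOR B6 over census vocabulary (`hMe` enters there as the currency of the cell condition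
`s(n) = 1`); Rédei–Reichardt discharged. Conditional; nothing asserted.
[cite: Monsky1990MockHeegner, Remark (3) (p. 67)] [cite: TianYuanZhang2017, Thm. 1.2, Thm. 3.3, Thm. 3.5]
[cite: HeathBrown1994SelmerCongruentII, Appendix (Monsky)] [cite: Miller2011LMS, Def. 1.1] [cite: RedeiReichardt1934, Satz (pp. 69–74)] -/
theorem congruentEvenBSDTwoAt_two_of_bridgedSystem_of_monskyEven
    (hU : ∀ (n : ℕ), Squarefree n → (n % 8 = 5 ∨ n % 8 = 6 ∨ n % 8 = 7) →
      ∃ L : ℤ, IsScriptL n L ∧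
        ((n % 8 = 5 ∨ n % 8 = 7) → (2 : ℤ) ∣ L →
          Even (genusSum₁ n fun d => genusClassNumber (GenusField d)) ∧
          Even (genusSum₂' n fun d => genusClassNumber (GenusField d))) ∧
        (n % 8 = 6 → (2 : ℤ) ∣ L → Even (genusSum₂' n fun d => genusClassNumber (GenusField d))))
    (hGZK : rank_eq_analyticRank_of_analyticRank_le_one) (hMe : monsky_card_selmerGroup_two_even)
    (hSys : tian2014_system_sMinus_bridged) : CongruentEvenBSDTwoAt 2 :=
  congruentEvenBSDTwoAt_two_of_genusSystem_of_monskyEven hU hGZK hMe redeiReichardt_fourTwoCard_classGroup_holds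
    (tian2014_system_sMinus_genus_of_split (tian2014_system_sMinus_split_of_bridged hSys))

end Summit.BirchSwinnertonDyer.Rank1Residual.P2

end
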